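import Summits.QuantumFields.BalabanUV.T4Continuum.Spine.NE1p.DressedSmallFieldTBoxMixedLetterSpectator

/-!
# T⁴ programme, spine estimate NE1′ (node O3b/H2) — THE THIRD RADIUS: the SOURCE derivative of the (1.23)∕(2.14) letter costs one more Cauchy
# radius — for `E(μ; t_□, σ)` jointly analytic in the source `|μ| < μ₁` and the contour variables, `μ ↦ (1.23)(μ)` is holomorphic (W93 at `P = ℂ`)
# and `|∂∕∂μ (1.23)(μ)| ≤ (μ₁′ − μ₀)⁻¹ · ρ⁻¹ · A · e^{−(κ₁−1)·#S}` on the STRICT sub-window `|μ| ≤ μ₀ < μ₁′ < μ₁` — the referee's precision note (n2)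

Cell `pub-balaban`, sub-cell `t4`, row NE1′ formalisation crew (`t4/formal/NE1p/LEAVES.md` row W98 ∕ DAG N29zzzzzm, BOOKED typer R-T153 journal
l.24791, cap 210, X-read X243 — own-initiative DICTIONARY follower of the unit's W93 «THE (1.23) TERM IS AN ANALYTIC FUNCTION OF THE SPECTATOR
CONFIGURATIONS» (p244127) and W89 (p242876) under R-T61 (ii)), unit `b2b-balaban-t4-ne1p-formalise-leaf-08` (gen 13).  ADDITIVE — imports W93 `Spine/NE1p/DressedSmallFieldTBoxMixedLetterSpectator` ONLY
(`analyticOnNhd_tBoxMixedLetter_spectator`, `analyticOnNhd_section`, `tBoxMixedLetter_eq_spectator`; → W89 `norm_tBoxMixedLetter_le`, W55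
`analyticOnNhd_apply`, W39.1 `mixedDiff`∕`μS`∕`wS`∕`σS`∕`mixedDiff_pair`, the substrate's `w₁`∕`circ`, the template's `polydisc` — BY NAME) + Mathlib
(`Complex.norm_deriv_le_of_forall_mem_sphere_norm_le`, `DifferentiableOn.diffContOnCl_ball`, `Filter.EventuallyEq.deriv_eq`).  THEOREMS ONLY + one
decided `example`; 0 `def`, 0 `instance`, 0 `def … : Prop`, 0 cite, 0 sorry, 0 `attribute`; nothing upstream restated.

WHY THIS FILE.  The NE1′ trigger's precision note (n2) (t4-ref2 pass 72, `t4/T4-NE1p-TRIGGER.json` scope_update_72, GAPS-T4 C-t4r2-340): «(2.14)–(2.15)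
consume Cauchy radii in σ(Z), τ(Y) (prefactor Π 2∕|τ(Y)|); termwise μ-differentiation needs a third radius in μ — the (w6) window |μ| ≤ μ₀ must be a
strict sub-window of the μ-analyticity domain, quotient into C₃» — a CELL-SIDE reading (the audited manuscript [Balaban1988RGII] has no observable
source μ: its E^{(k+1)}(X; μ) is the owner's extension, note (n1)); nothing of print is quoted here beyond W89's loci.  W89 typed (1.23) with TWO
radii (the t_□-circle `ρ`, the σ(Δ)-circles), W93 made the letter analytic in a Banach spectator.  At `P = ℂ` the spectator IS the source, and the
third radius is one line of Cauchy:
* §1 **`norm_deriv_le_of_strict_window`** [folklore]: `f` holomorphic on `{|z| < μ₁}`, `‖f‖ ≤ B` on `{|z| ≤ μ₁′}`, `μ₀ < μ₁′ < μ₁`, `|μ| ≤ μ₀` ⇒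
  `‖f′(μ)‖ ≤ B∕(μ₁′ − μ₀)` (Mathlib's Cauchy estimate on the circle of radius `μ₁′ − μ₀` about `μ`);
* §2 **`differentiableOn_letter_source`**: for `E(μ; t_□, σ)` JOINTLY analytic on `{|μ| < μ₁} × {|t| < R₀} × Π_j{|σ_j| < R_{j+1}}`, `0 < ρ < R₀`,
  `1 < r_j < R_{j+1}`, the letter `μ ↦ ∫_{θ_□} w₁ ρ (0,θ_□)·(∫ wS r S p·E(μ; circ ρ θ_□ ∷ σ_S p) d(⨂ μS S)) dθ_□` is holomorphic on `{|μ| < μ₁}` (W93 at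
  `P := ℂ`, `W := ball 0 μ₁`);
* §3 **`norm_deriv_letter_source_le`**: with `κ₁ ≥ 1`, `R_{j+1} > e^{κ₁}` and a bound `‖E(μ′; t ∷ z)‖ ≤ A` for `|μ′| ≤ μ₁′`, `|t| = ρ`, `|z_j| ≤ e^{κ₁}`
  (a HYPOTHESIS of (1.21)-TYPE for the cell's μ-extended data): for `|μ| ≤ μ₀`,
  `‖∂∕∂μ (letter)(μ)‖ ≤ ρ⁻¹·(A·e^{−(κ₁−1)·#S})∕(μ₁′ − μ₀)` — THREE radii: `ρ` (t_□), `e^{κ₁}` (σ), `μ₁′ − μ₀` (source); W89 `norm_tBoxMixedLetter_le` on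
  every section over the closed sub-disc + §1; **`norm_letter_sub_le_source`**: hence `‖letter(μ′) − letter(μ)‖ ≤ (that bound)·‖μ′ − μ‖` on
  `|μ|, |μ′| ≤ μ₀` (mean value inequality on the convex disc) — the source difference is LINEAR in the displacement;
* §4 decided: `E(μ; t, z₀, z₁) = μ²·t·z₀z₁` (source disc `|μ| < 2`, t_□-radius `1`, cube radii `3∕2`): the letter IS `μ²` on the disc (W93), so its
  source derivative at `μ = ½`, computed THROUGH the letter (`Filter.EventuallyEq.deriv_eq`), is `1`.

HONEST FRAMING.  [folklore] one-variable Cauchy estimate (Mathlib) + W93∕W89 BY NAME on OUR dictionary objects; a DICTIONARY row — the cell's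
(n2)-type bookkeeping for the SOURCE variable of a (2.14)-type letter, NOT an estimate of print and NOT a statement about Bałaban's densities: the
μ-extension is the cell's (note (n1)), `A`, the radii and the windows are HYPOTHESES∕symbols, «quotient into C₃» and (2.15)'s Lemma-3 combinatorics
are NOT touched; no numeral of [Balaban1988RGII] asserted (k2); (B1) for Bałaban's (2.14) NOT discharged; (B3) = GAPS G-ne9p2-5 UNPRINTED — NOT
discharged, untouched; (B5) untouched; (w6) NOT discharged (the strict sub-window is DISPLAYED as the hypothesis `μ₀ < μ₁′ < μ₁`); 0 binders
instantiated on Bałaban's densities ∕ operators ∕ (2.14) data ∕ `d_k` ∕ minimisers ∕ backgrounds; discharges no wall item; wall v1.8 (T4-DAG v48)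
does NOT move; R-t4r2-Q2 NOT met thereby; NE1′ ⇐ the named binders — NOT proved, NOT printed; spine PROVED 0∕9; count 9 unchanged.  Rung (B)+1 on
ONE finite four-torus — NOT infinite volume, NOT a mass gap, NOT OS on ℝ⁴, NOT Clay.  ABSOLUTE RULE honoured: the referee note is a CELL record
(GAPS-T4), quoted as such, not as print; W89's p. 7 loci remain TYPE∕CONTEXT; nothing internally minted is cited as a fact; [folklore] tags on
kernel lemmas only.  HONEST DEPENDENCY: continuum YM on T⁴ ⇐ BetaPertH ∧ nine spine estimates (0/9 proved); BetaPertH ⇐ (D1) ∧ (D4) ∧ CAP+tail;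
G-an2-4 gates asym, D1 and NE2/3/4.
-/

noncomputable section

namespace Summit.QuantumFields.BalabanUV.T4Continuum.NE1p.DressedSmallFieldTBoxMixedLetterThirdRadius

open MeasureTheory Metric Set Complex Finset Function
open scoped BigOperators
open Summit.QuantumFields.BalabanUV.T4Continuum.B13TermContours
open Summit.QuantumFields.BalabanUV.T4Continuum.NE1p.DressedSmallFieldMixedLetter
open Summit.QuantumFields.BalabanUV.T4Continuum.NE1p.DressedSmallFieldTBoxMixedLetterLocal (norm_tBoxMixedLetter_le)
open Summit.QuantumFields.BalabanUV.T4Continuum.NE1p.DressedSmallFieldTBoxMixedLetterSpectator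
open Literature.MathematicalPhysics.QuantumFieldTheory.Dimock2011to13.PolydiscCauchyBounds (polydisc)

variable {n : ℕ}

/-! ## §1 [folklore] Cauchy's estimate on a disc strictly inside the disc of analyticity -/

/-- **ONE MORE RADIUS** [folklore] (Mathlib `Complex.norm_deriv_le_of_forall_mem_sphere_norm_le` on the circle of radius `μ₁′ − μ₀` about `μ`, which
stays in the closed disc `|z| ≤ μ₁′` where the bound holds, inside the open disc `|z| < μ₁` of analyticity): for `f` holomorphic on `{|z| < μ₁}`,
`‖f‖ ≤ B` on `{|z| ≤ μ₁′}`, `μ₀ < μ₁′ < μ₁`, and `|μ| ≤ μ₀`: `‖f′(μ)‖ ≤ B∕(μ₁′ − μ₀)`. -/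
theorem norm_deriv_le_of_strict_window {f : ℂ → ℂ} {μ₁ μ₁' μ₀ B : ℝ} (h01 : μ₀ < μ₁') (h1 : μ₁' < μ₁)
    (hf : DifferentiableOn ℂ f (ball (0 : ℂ) μ₁)) (hB : ∀ z ∈ closedBall (0 : ℂ) μ₁', ‖f z‖ ≤ B) {μ : ℂ} (hμ : ‖μ‖ ≤ μ₀) :
    ‖deriv f μ‖ ≤ B / (μ₁' - μ₀) := by
  have hR : 0 < μ₁' - μ₀ := sub_pos.2 h01
  have hsub : closedBall μ (μ₁' - μ₀) ⊆ closedBall (0 : ℂ) μ₁' := fun z hz => by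
    rw [mem_closedBall, dist_zero_right]
    have h := mem_closedBall.1 hz
    rw [dist_eq_norm] at h
    calc ‖z‖ = ‖(z - μ) + μ‖ := by rw [sub_add_cancel]
      _ ≤ ‖z - μ‖ + ‖μ‖ := norm_add_le _ _
      _ ≤ (μ₁' - μ₀) + μ₀ := add_le_add h hμ
      _ = μ₁' := by ring
  have hsubU : closedBall μ (μ₁' - μ₀) ⊆ ball (0 : ℂ) μ₁ := hsub.trans (closedBall_subset_ball h1)
  exact Complex.norm_deriv_le_of_forall_mem_sphere_norm_le hR (hf.diffContOnCl_ball hsubU)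
    fun z hz => hB z (hsub (sphere_subset_closedBall hz))

/-! ## §2 THE SOURCE AS THE SPECTATOR: the (1.23) letter is analytic in `μ` (W93 at `P = ℂ`) -/

/-- **THE LETTER IS HOLOMORPHIC IN THE SOURCE** [folklore] (W93 `analyticOnNhd_tBoxMixedLetter_spectator` at `P := ℂ`, `W := ball 0 μ₁`): for
`E(μ; t_□, σ)` JOINTLY analytic on `{|μ| < μ₁} × {|t| < R₀} × Π_j{|σ_j| < R_{j+1}}`, `0 < ρ < R₀`, `1 < r_j < R_{j+1}`, the letter
`μ ↦ ∫_{θ_□} w₁ ρ (0,θ_□)·(∫ wS r S p·E(μ; circ ρ θ_□ ∷ σ_S p) d(⨂ μS S)) dθ_□` is complex differentiable on `{|μ| < μ₁}`. -/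
theorem differentiableOn_letter_source {μ₁ ρ : ℝ} (hρ : 0 < ρ) {r : Fin n → ℝ} {R : Fin (n + 1) → ℝ} (hρR : ρ < R 0)
    (hr : ∀ j, 1 < r j) (hrR : ∀ j : Fin n, r j < R j.succ) (S : Finset (Fin n)) {E : ℂ → (Fin (n + 1) → ℂ) → ℂ}
    (hE : AnalyticOnNhd ℂ (fun q : ℂ × (Fin (n + 1) → ℂ) => E q.1 q.2) (ball (0 : ℂ) μ₁ ×ˢ Set.univ.pi fun j => ball (0 : ℂ) (R j))) :
    DifferentiableOn ℂ (fun μ : ℂ => ∫ θ₀ in Icc 0 (2 * Real.pi), w₁ ρ (0, θ₀) *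
        ∫ p, wS r S p * E μ (Fin.cons (circ ρ θ₀) (σS r S p)) ∂(Measure.pi (μS S))) (ball (0 : ℂ) μ₁) :=
  (analyticOnNhd_tBoxMixedLetter_spectator isOpen_ball hρ hρR hr hrR S hE).differentiableOn

/-! ## §3 THE THIRD RADIUS: the source derivative of (1.23) on the strict sub-window -/

/-- **THE SOURCE DERIVATIVE OF (1.23) COSTS ONE MORE CAUCHY RADIUS** (kernel; §2 + W89 `norm_tBoxMixedLetter_le` on every section over the closed
sub-disc (W93 `analyticOnNhd_section`) + §1): for `E(μ; t_□, σ)` JOINTLY analytic on `{|μ| < μ₁} × {|t| < R₀} × Π_j{|σ_j| < R_{j+1}}`, `κ₁ ≥ 1`, `R_{j+1} > e^{κ₁}`, `0 < ρ < R₀`, contour radii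
`1 < r_j < R_{j+1}`, a bound `‖E(μ; t ∷ z)‖ ≤ A` for `|μ| ≤ μ₁′`, `|t| = ρ`, `|z_j| ≤ e^{κ₁}` (a HYPOTHESIS of (1.21)∕(2.14)-data TYPE), and the STRICT
sub-window `μ₀ < μ₁′ < μ₁`: for every `|μ| ≤ μ₀`,
`‖∂∕∂μ ∫_{θ_□} w₁ ρ (0,θ_□)·(∫ wS r S p·E(μ; circ ρ θ_□ ∷ σ_S p) d(⨂ μS S)) dθ_□‖ ≤ (μ₁′ − μ₀)⁻¹ · (ρ⁻¹ · (A · e^{−(κ₁−1)·#S}))` — the THREE radii of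
the (2.14)-type letter: `ρ` (t_□-circle), `e^{κ₁}` (σ-circles), `μ₁′ − μ₀` (source).  This is the referee's precision note (n2) on the NE1′
trigger in dictionary form: «termwise μ-differentiation needs a third radius in μ — the (w6) window |μ| ≤ μ₀ must be a strict sub-window of the
μ-analyticity domain» (TYPE; the quotient «into C₃» is NOT touched). [folklore] -/
theorem norm_deriv_letter_source_le {μ₁ μ₁' μ₀ ρ : ℝ} (h01 : μ₀ < μ₁') (h1 : μ₁' < μ₁) (hρ : 0 < ρ) {r : Fin n → ℝ}
    {R : Fin (n + 1) → ℝ} (hρR : ρ < R 0) (hr : ∀ j, 1 < r j) (hrR : ∀ j : Fin n, r j < R j.succ) {κ₁ A : ℝ} (hκ : 1 ≤ κ₁)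
    (hRκ : ∀ j : Fin n, Real.exp κ₁ < R j.succ) (S : Finset (Fin n)) {E : ℂ → (Fin (n + 1) → ℂ) → ℂ}
    (hE : AnalyticOnNhd ℂ (fun q : ℂ × (Fin (n + 1) → ℂ) => E q.1 q.2) (ball (0 : ℂ) μ₁ ×ˢ Set.univ.pi fun j => ball (0 : ℂ) (R j)))
    (hA : ∀ μ' ∈ closedBall (0 : ℂ) μ₁', ∀ t : ℂ, ‖t‖ = ρ → ∀ z ∈ polydisc (fun _ : Fin n => Real.exp κ₁), ‖E μ' (Fin.cons t z)‖ ≤ A)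
    {μ : ℂ} (hμ : ‖μ‖ ≤ μ₀) :
    ‖deriv (fun μ' : ℂ => ∫ θ₀ in Icc 0 (2 * Real.pi), w₁ ρ (0, θ₀) *
        ∫ p, wS r S p * E μ' (Fin.cons (circ ρ θ₀) (σS r S p)) ∂(Measure.pi (μS S))) μ‖ ≤
      ρ⁻¹ * (A * Real.exp (-((κ₁ - 1) * S.card))) / (μ₁' - μ₀) :=
  norm_deriv_le_of_strict_window h01 h1 (differentiableOn_letter_source hρ hρR hr hrR S hE)
    (fun μ' hμ' => norm_tBoxMixedLetter_le hρ hρR hr hrR hκ hRκ S (analyticOnNhd_section hE (closedBall_subset_ball h1 hμ')) (hA μ' hμ')) hμ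

/-- **… HENCE THE LETTER IS LIPSCHITZ IN THE SOURCE ON THE WINDOW** [folklore] (§3 + the mean value inequality on the convex disc `|μ| ≤ μ₀`,
Mathlib `Convex.norm_image_sub_le_of_norm_deriv_le`): for `|μ|, |μ′| ≤ μ₀`,
`‖letter(μ′) − letter(μ)‖ ≤ (ρ⁻¹·(A·e^{−(κ₁−1)·#S})∕(μ₁′ − μ₀))·‖μ′ − μ‖` — the source DIFFERENCE of the (1.23) term is linear in the displacement,
the shape of the cell's (w5)∕(w6) regeneration currencies (S52∕S55's «Cauchy form `M·σ∕(ε − σ)`» read at the letter object; nothing of theirs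
imported or restated). -/
theorem norm_letter_sub_le_source {μ₁ μ₁' μ₀ ρ : ℝ} (h01 : μ₀ < μ₁') (h1 : μ₁' < μ₁) (hρ : 0 < ρ) {r : Fin n → ℝ}
    {R : Fin (n + 1) → ℝ} (hρR : ρ < R 0) (hr : ∀ j, 1 < r j) (hrR : ∀ j : Fin n, r j < R j.succ) {κ₁ A : ℝ} (hκ : 1 ≤ κ₁)
    (hRκ : ∀ j : Fin n, Real.exp κ₁ < R j.succ) (S : Finset (Fin n)) {E : ℂ → (Fin (n + 1) → ℂ) → ℂ}
    (hE : AnalyticOnNhd ℂ (fun q : ℂ × (Fin (n + 1) → ℂ) => E q.1 q.2) (ball (0 : ℂ) μ₁ ×ˢ Set.univ.pi fun j => ball (0 : ℂ) (R j)))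
    (hA : ∀ μ' ∈ closedBall (0 : ℂ) μ₁', ∀ t : ℂ, ‖t‖ = ρ → ∀ z ∈ polydisc (fun _ : Fin n => Real.exp κ₁), ‖E μ' (Fin.cons t z)‖ ≤ A)
    {μ μ' : ℂ} (hμ : ‖μ‖ ≤ μ₀) (hμ' : ‖μ'‖ ≤ μ₀) :
    ‖(∫ θ₀ in Icc 0 (2 * Real.pi), w₁ ρ (0, θ₀) *
          ∫ p, wS r S p * E μ' (Fin.cons (circ ρ θ₀) (σS r S p)) ∂(Measure.pi (μS S))) -
        ∫ θ₀ in Icc 0 (2 * Real.pi), w₁ ρ (0, θ₀) *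
          ∫ p, wS r S p * E μ (Fin.cons (circ ρ θ₀) (σS r S p)) ∂(Measure.pi (μS S))‖ ≤
      ρ⁻¹ * (A * Real.exp (-((κ₁ - 1) * S.card))) / (μ₁' - μ₀) * ‖μ' - μ‖ := by
  have hball : ∀ x ∈ closedBall (0 : ℂ) μ₀, x ∈ ball (0 : ℂ) μ₁ := fun x hx =>
    mem_ball_zero_iff.2 (lt_of_le_of_lt (mem_closedBall_zero_iff.1 hx) (h01.trans h1))
  exact (convex_closedBall (0 : ℂ) μ₀).norm_image_sub_le_of_norm_deriv_le
    (fun x hx => ((differentiableOn_letter_source hρ hρR hr hrR S hE) x (hball x hx)).differentiableAt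
      (isOpen_ball.mem_nhds (hball x hx)))
    (fun x hx => norm_deriv_letter_source_le h01 h1 hρ hρR hr hrR hκ hRκ S hE hA (mem_closedBall_zero_iff.1 hx))
    (mem_closedBall_zero_iff.2 hμ) (mem_closedBall_zero_iff.2 hμ')

/-! ## §4 Decided check: the source enters quadratically -/

/-- [folklore] The decided datum `E(μ; t, z₀, z₁) = μ²·t·z₀z₁` is jointly analytic everywhere. -/
theorem analyticOnNhd_source_toy (W : Set ℂ) (R : Fin 3 → ℝ) :
    AnalyticOnNhd ℂ (fun q : ℂ × (Fin 3 → ℂ) => q.1 ^ 2 * q.2 0 * (q.2 (Fin.succ 0) * q.2 (Fin.succ 1)))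
      (W ×ˢ Set.univ.pi fun j => ball (0 : ℂ) (R j)) := by
  have hc : ∀ i : Fin 3, AnalyticOnNhd ℂ (fun q : ℂ × (Fin 3 → ℂ) => q.2 i) (W ×ˢ Set.univ.pi fun j => ball (0 : ℂ) (R j)) := fun i =>
    ((Summit.QuantumFields.BalabanUV.T4Continuum.NE1p.DressedSmallFieldMixedDerivativeBridge.analyticOnNhd_apply (n := 3) i).comp
      analyticOnNhd_snd (mapsTo_univ _ _))
  exact ((analyticOnNhd_fst.pow 2).mul (hc 0)).mul ((hc _).mul (hc _))

/-- DECIDED CHECK: for `E(μ; t, z₀, z₁) = μ²·t·z₀z₁` (source disc `|μ| < 2`, t_□-radius `1 < 2`, cube radii `3∕2 < 2`) the letter at the source `μ`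
IS `μ²` (W93), so its source derivative at `μ = 1∕2` is `1` — computed through the letter: `deriv` of the letter agrees with `deriv (μ ↦ μ²)` at the
interior point (`Filter.EventuallyEq.deriv_eq`). -/
example : deriv (fun μ : ℂ => ∫ θ₀ in Icc 0 (2 * Real.pi), w₁ 1 (0, θ₀) *
    ∫ p : Fin 2 → ℝ × ℝ, wS (fun _ => (3 / 2 : ℝ)) {0, 1} p *
      (μ ^ 2 * circ 1 θ₀ * (σS (fun _ => (3 / 2 : ℝ)) {0, 1} p 0 * σS (fun _ => (3 / 2 : ℝ)) {0, 1} p 1)) ∂(Measure.pi (μS {0, 1})))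
    (1 / 2 : ℂ) = 1 := by
  -- the letter IS `μ²` on the source disc `|μ| < 2`
  have hletter : ∀ μ ∈ ball (0 : ℂ) 2, (∫ θ₀ in Icc 0 (2 * Real.pi), w₁ 1 (0, θ₀) *
      ∫ p : Fin 2 → ℝ × ℝ, wS (fun _ => (3 / 2 : ℝ)) {0, 1} p *
        (μ ^ 2 * circ 1 θ₀ * (σS (fun _ => (3 / 2 : ℝ)) {0, 1} p 0 * σS (fun _ => (3 / 2 : ℝ)) {0, 1} p 1)) ∂(Measure.pi (μS {0, 1}))) = μ ^ 2 := by
    intro μ hμ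
    have h := tBoxMixedLetter_eq_spectator (n := 2) (W := ball (0 : ℂ) 2) (ρ := 1) one_pos (r := fun _ => 3 / 2) (R := fun _ => 2) (by norm_num)
      (fun _ => by norm_num) (fun _ => by norm_num) {0, 1} (E := fun u v => u ^ 2 * v 0 * (v (Fin.succ 0) * v (Fin.succ 1)))
      (analyticOnNhd_source_toy _ _) hμ
    simp only [Fin.cons_zero, Fin.cons_succ] at h
    rw [h]
    have hd : ∀ w : Fin 2 → ℂ, HasDerivAt (fun t : ℂ => μ ^ 2 * t * (w 0 * w 1)) (μ ^ 2 * 1 * (w 0 * w 1)) 0 := fun w =>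
      ((hasDerivAt_id (0 : ℂ)).const_mul (μ ^ 2)).mul_const (w 0 * w 1)
    simp_rw [(hd _).deriv, mixedDiff_pair]
    norm_num
  have hev : (fun μ : ℂ => ∫ θ₀ in Icc 0 (2 * Real.pi), w₁ 1 (0, θ₀) *
      ∫ p : Fin 2 → ℝ × ℝ, wS (fun _ => (3 / 2 : ℝ)) {0, 1} p *
        (μ ^ 2 * circ 1 θ₀ * (σS (fun _ => (3 / 2 : ℝ)) {0, 1} p 0 * σS (fun _ => (3 / 2 : ℝ)) {0, 1} p 1)) ∂(Measure.pi (μS {0, 1}))) =ᶠ[nhds (1 / 2 : ℂ)]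
      fun μ => μ ^ 2 :=
    Filter.eventuallyEq_of_mem (isOpen_ball.mem_nhds (by rw [mem_ball_zero_iff]; norm_num)) hletter
  rw [hev.deriv_eq]
  have hsq : HasDerivAt (fun μ : ℂ => μ ^ 2) (((2 : ℕ) : ℂ) * (1 / 2 : ℂ) ^ (2 - 1)) (1 / 2 : ℂ) := hasDerivAt_pow 2 _
  rw [hsq.deriv]; norm_num

end Summit.QuantumFields.BalabanUV.T4Continuum.NE1p.DressedSmallFieldTBoxMixedLetterThirdRadius

end
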